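import Mathlib
import Summits.Langlands.Langlands.Cruxes.StableYoshidaCongruence.IdeaSketchRound1Seat1

/-!
# Triage evidence (refuter, crux-triage r1-2 gen 2): the two commutative-algebra "first lemmas"
of the idea cards `paramodular-purity-torsion-locus` (`KerFullSupport`) and
`wall-companion-trichotomy` (`CokerFreeIffResiduallyInjective`), exactly as typed in the in-tree
sketch `Cruxes/StableYoshidaCongruence/IdeaSketchRound1Seat1.lean`, are TRUE (sorry-free below).
Positive lemmas: evidence only, not landable by a refuter.
-/

set_option linter.dupNamespace false

namespace Summit.Langlands.Langlands.Cruxes.StableYoshidaCongruence.TriageR1Seat2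

open Summit.Langlands.Langlands.Cruxes.StableYoshidaCongruence.IdeaSketch

/-- `KerFullSupport` holds: a non-zero submodule of a free module over a domain is torsion-free
and non-trivial, hence supported everywhere (`Module.support_of_noZeroSMulDivisors`).  The
Noetherian and finiteness hypotheses are not used. -/
theorem kerFullSupport_holds : KerFullSupport := by
  intro Λ _ _ _ M N _ _ _ _ _ _ _ _ f hf
  haveI : Nontrivial (LinearMap.ker f) := Submodule.nontrivial_iff_ne_bot.mpr hf
  exact Module.support_of_noZeroSMulDivisors

/-- `CokerFreeIffResiduallyInjective` holds: for an injective map `f : M → N` of finite free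
modules over a local ring, `N ⧸ range f` is free iff `f ⊗ κ` is injective (local criterion:
`Module.free_of_lTensor_residueField_injective` and the splitting lemma).  Noetherianity is not
used. -/
theorem cokerFreeIffResiduallyInjective_holds : CokerFreeIffResiduallyInjective := by
  intro Λ _ _ _ M N _ _ _ _ _ _ _ _ f hf
  constructor
  · intro hfree
    -- the sequence `0 → M → N → N ⧸ range f → 0` splits since the quotient is projective
    have hex : Function.Exact f (LinearMap.range f).mkQ := LinearMap.exact_map_mkQ_range f
    have htfae := (Function.Exact.split_tfae hex hf (Submodule.mkQ_surjective _)).out 0 1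
    obtain ⟨l', hl'⟩ := htfae.mp
      (Module.projective_lifting_property _ _ (Submodule.mkQ_surjective _))
    exact (IsLocalRing.split_injective_iff_lTensor_residueField_injective f).mp ⟨l', hl'⟩
  · intro hinj
    exact Module.free_of_lTensor_residueField_injective f (LinearMap.range f).mkQ
      (Submodule.mkQ_surjective _) (LinearMap.exact_map_mkQ_range f) hinj

end Summit.Langlands.Langlands.Cruxes.StableYoshidaCongruence.TriageR1Seat2
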